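/-
Origin: expansion seat `prover-pub-hodgecm-prl2-g2-0`, handover 2026-08-18T04:10:10Z (`HOME/pub-hodgecm-prl2-g2/lean/Prl2g2/SupplySplit.lean`, md5 bf6ed757, 274 lines);
landed by the gen-5 packager in gate run 21 as `HodgeCM/StubTree/SupplySplit.lean` (verbatim).
-/
/-
Origin: HOME/pub-hodgecm-prl2-g2/lean/Prl2g2/SupplySplit.lean — session planner-pub-hodgecm-prl2-g2-0 (unit pub-hodgecm-prl2,
gen 2: expansion prover a-2, REDUCE, don't construct).  Intended final place: `HodgeCM/StubTree/SupplySplit.lean`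
(imports `HodgeCM.StubTree.RealisationReduction`, the gen-1 file).  Nothing here is asserted: every published input is a
named `Prop` consumed as an explicit hypothesis; every `theorem` is kernel-checked, no placeholders.
-/
import Summits.HodgeConjecture.HodgeCM.StubTree.RealisationReduction

set_option autoImplicit false

/-!
# The supply piece, split by side — only the (12)-pair is an input

`HodgeCM.StubTree.RealisationReduction` (gen 1) closed `PeriodNV` from three pieces over the geometric primitives:
(S) `TypeSupplyAt` — ALL FOUR isotypic spaces `U_{Ψ_i}(Γ)` nonzero at one common level, (V) `VirtualCup11`
(Venkataramana, Compositio Math. 125 (2001) Thm 8, p. 229 — verbatim print) and (P) `PairingAt`.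

This file records two sharpenings of the SUPPLY side, both kernel-checked, and what they mean for the reduction dossier
(`HOME/pub-hodgecm-prl2-g2/REDUCTION-v2.md`):

1. **Only the (12)-pair is an input.**  The assembly consumes supply for `i = 0, 1` only; supply for `i = 2, 3` is an
   OUTPUT (`typeSupplyAt_of_supply01_freePairing`: (S₀₁) ∧ (P♯) ⇒ `PeriodNV` ⇒ (S) for all four, by the honesty lemma
   `typeSupplyAt_of_periodNV`).  This is the geometric shadow of the observation (dossier §3, GAPS.md `prl2g2-X1`) that in
   PerL v5 the (34)-side needs NO theta non-vanishing at all: `S₃₄ = S₁₂ ≠ 0` is Thm 3.7 + Prop 4.3, and the global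
   non-vanishing theorem Lemma 4.2(b) (Rallis inner product formula, doubling, Siegel–Weil: LEMMAS.md N31 cluster) is not
   on the critical path of Thm 4.4.

2. **Separate levels suffice.**  Print supply statements (Liu, Cambridge J. Math. 9 (2021) = arXiv:2102.11518 Thm 4.18 with
   Prop 4.13: `Hom(Alb, A_μ) ≠ 0` at SOME neat level, per type) give each type at ITS OWN level.  Merging two levels needs
   either injectivity of pull-back along coverings (not a `Universe` primitive: `U.Mor` contains constant maps) or — free of
   any new primitive — Venkataramana's theorem read for classes at two finite levels of the same tower (V₂, `VirtualCup11₂`: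
   the same THEOREM 8, whose `H(Sh⁰G) = lim_Γ H^*(S_Γ)` receives every finite level injectively — transfer for finite covers
   of compact manifolds), which merges the levels and makes the wedge nonzero in one move:
   `periodNV_of_pieces₂ : Fact_pull_comp → (S₀₁ᵉ) → (V₂) → (P) → PeriodNV`.

Items (all `HodgeCM.Universe.*`): defs `TypeSupply01At`, `TypeSupplyEach01`, `VirtualCup11₂`, `Fact_virtualCup11₂`,
`FreePairing2At`, binder versions `TypeSupplyEach01PerL/Face`; theorems `typeSupply01At_of_typeSupplyAt`,
`typeSupplyEach01_of_typeSupply01At`, `virtualCup11_of_virtualCup11₂`, `freePairingAt_of_freePairing2At`,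
`periodNV_of_supply01_freePairing`, `typeSupplyAt_of_supply01_freePairing`, `freePairing2At_of_virtualCup2_pairing`,
`periodNV_of_supplyEach01_freePairing2`, `periodNV_of_pieces₂`, `perL44_of_pieces₂`, `periodThmF_of_pieces₂`,
`perL_of_pieces₂`, `w_rk4_of_pieces₂`, `COR_CM_of_pieces₂`.
-/

noncomputable section

namespace HodgeCM

namespace Universe

variable (U : Universe)

open Literature.AlgebraicGeometry.Motives (CMType)

/-! ### (S₀₁) Supply of the (12)-pair only -/

/-- **(S₀₁) Supply of the (12)-pair at a common level**: at some level `Γ` the isotypic spaces `U_{Ψ₀}(Γ)` and `U_{Ψ₁}(Γ)`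
are both nonzero.  Weaker than (S) `TypeSupplyAt` (all four types); it is all the assembly `periodNV_of_supply_freePairing`
ever used (`periodNV_of_supply01_freePairing`).  SOURCES: as for `TypeSupplyAt` (Liu 2021 Thm 4.18 + Prop 4.13 per type, the
CM-typing dictionary; dossier REDUCTION-v2.md §1).  WHY IT MIGHT FAIL: only through the dictionary's sign conventions
(which type is carried by which line), harmless for supply. -/
def TypeSupply01At {L : CMField} {ι₁ : L →+* ℂ} (V : HermSpace3 L ι₁) (K : CMField) (Ψ : Fin 4 → CMType K)
    (σ : K →+* ℂ) : Prop :=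
  ∃ Γ : Level V, U.Uiso Γ K (Ψ 0) σ ≠ ⊥ ∧ U.Uiso Γ K (Ψ 1) σ ≠ ⊥

/-- **(S₀₁ᵉ) Supply of the (12)-pair, each type at its own level** — the shape in which print delivers it (one neat level
per type: Liu 2021 Thm 4.18 (2) with Prop 4.13, `m(μ, μ_K^♮, ε) = 1 ⇒ Hom(A_{K^♮}, A_μ) ≠ 0` for a μ-admissible `ε`). -/
def TypeSupplyEach01 {L : CMField} {ι₁ : L →+* ℂ} (V : HermSpace3 L ι₁) (K : CMField) (Ψ : Fin 4 → CMType K)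
    (σ : K →+* ℂ) : Prop :=
  (∃ Γ : Level V, U.Uiso Γ K (Ψ 0) σ ≠ ⊥) ∧ (∃ Γ : Level V, U.Uiso Γ K (Ψ 1) σ ≠ ⊥)

/-! ### (V₂) Venkataramana's Theorem 8 for classes at two levels -/

/-- **(V₂) Virtual non-vanishing of `H¹ ∪ H¹`, two source levels**: for nonzero `ω ∈ H¹(P_{Γ₀}, ℂ)`, `η ∈ H¹(P_{Γ₁}, ℂ)` there
are a level `Γ′` and morphisms `f : P_{Γ′} → P_{Γ₀}`, `g : P_{Γ′} → P_{Γ₁}` of the tower with `f^*ω ∪ g^*η ≠ 0`.  SOURCE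
(verbatim, as for `VirtualCup11`): Venkataramana, Compositio Math. 125 (2001) THEOREM 8, p. 229 — "Let a, a′ be non-zero
cohomology classes of degrees k, k′ in H(Sh⁰G) with k + k′ ≤ n. Then there exists a g ∈ Ḡ_f such that g(a) ∧ a′ ≠ 0", with
`H(Sh⁰G) = lim_Γ H^*(S_Γ, ℂ)`; a nonzero class at ANY finite congruence level `Γ₀` (resp. `Γ₁`) is a nonzero element of the
limit (pull-back along a finite covering of compact manifolds is injective on cohomology with ℂ-coefficients: transfer), and
`g(a) ∧ a′ ≠ 0` in the limit is realised at a common finite level `Γ′` by pull-back along morphisms of varieties (Hecke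
translate composed with coverings).  `VirtualCup11` is the special case `Γ₀ = Γ₁` (`virtualCup11_of_virtualCup11₂`).  WHY IT
MIGHT FAIL: only as typed, exactly as for `VirtualCup11`. -/
def VirtualCup11₂ {L : CMField} {ι₁ : L →+* ℂ} (V : HermSpace3 L ι₁) : Prop :=
  ∀ (Γ₀ Γ₁ : Level V) (ω : U.CohC (U.pms L ι₁ V Γ₀) 1) (η : U.CohC (U.pms L ι₁ V Γ₁) 1), ω ≠ 0 → η ≠ 0 →
    ∃ (Γ' : Level V) (f : U.Mor (U.pms L ι₁ V Γ') (U.pms L ι₁ V Γ₀)) (g : U.Mor (U.pms L ι₁ V Γ') (U.pms L ι₁ V Γ₁)),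
      U.cup2C (U.pms L ι₁ V Γ') 1 (U.pullC f 1 ω) (U.pullC g 1 η) ≠ 0

/-- **Model-fact candidate** (same print theorem as `Fact_virtualCup11`, read at two finite levels): Venkataramana's
Theorem 8 for every compact Picard modular tower of the universe (`[L:ℚ] ≥ 4`). -/
def Fact_virtualCup11₂ : Prop :=
  ∀ (L : CMField) (ι₁ : L →+* ℂ), 4 ≤ Module.finrank ℚ L → ∀ V : HermSpace3 L ι₁, U.VirtualCup11₂ V

/-! ### (P♯₂) The free pairing step with two source levels -/

/-- **(P♯₂) Free pairing, two source levels**: nonzero one-forms `ω₀ ∈ U_{Ψ₀}(Γ₀)`, `ω₁ ∈ U_{Ψ₁}(Γ₁)` have pull-backs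
`f₀^*ω₀`, `f₁^*ω₁` to some level `Γ′` and one-forms `ω₂, ω₃` of types `(Ψ₂, Ψ₃)` there with
`∫ f₀^*ω₀ ∧ f₁^*ω₁ ∧ \overline{ω₂ ∧ ω₃} ≠ 0`.  Implied by (V₂) ∧ (P) (`freePairing2At_of_virtualCup2_pairing`); implies (P♯)
(`freePairingAt_of_freePairing2At`).  SOURCES / WHY IT MIGHT FAIL: as for `FreePairingAt`. -/
def FreePairing2At {L : CMField} {ι₁ : L →+* ℂ} (V : HermSpace3 L ι₁) (K : CMField) (Ψ : Fin 4 → CMType K)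
    (σ : K →+* ℂ) : Prop :=
  ∀ (Γ₀ Γ₁ : Level V) (ω₀ : U.CohC (U.pms L ι₁ V Γ₀) 1) (ω₁ : U.CohC (U.pms L ι₁ V Γ₁) 1),
    ω₀ ∈ U.Uiso Γ₀ K (Ψ 0) σ → ω₁ ∈ U.Uiso Γ₁ K (Ψ 1) σ → ω₀ ≠ 0 → ω₁ ≠ 0 →
    ∃ (Γ' : Level V) (f₀ : U.Mor (U.pms L ι₁ V Γ') (U.pms L ι₁ V Γ₀)) (f₁ : U.Mor (U.pms L ι₁ V Γ') (U.pms L ι₁ V Γ₁))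
      (ω : Fin 4 → U.CohC (U.pms L ι₁ V Γ') 1),
      ω 0 = U.pullC f₀ 1 ω₀ ∧ ω 1 = U.pullC f₁ 1 ω₁ ∧
      ω 2 ∈ U.Uiso Γ' K (Ψ 2) σ ∧ ω 3 ∈ U.Uiso Γ' K (Ψ 3) σ ∧
      U.period (U.pms L ι₁ V Γ') ω ≠ 0

variable {U}

/-! ### Comparisons -/

/-- (Ported verbatim from the HodgeCMPerL package; no docstring in the source.) -/
theorem typeSupply01At_of_typeSupplyAt {L : CMField} {ι₁ : L →+* ℂ} {V : HermSpace3 L ι₁} {K : CMField}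
    {Ψ : Fin 4 → CMType K} {σ : K →+* ℂ} (h : U.TypeSupplyAt V K Ψ σ) : U.TypeSupply01At V K Ψ σ := by
  obtain ⟨Γ, hΓ⟩ := h
  exact ⟨Γ, hΓ 0, hΓ 1⟩

/-- (Ported verbatim from the HodgeCMPerL package; no docstring in the source.) -/
theorem typeSupplyEach01_of_typeSupply01At {L : CMField} {ι₁ : L →+* ℂ} {V : HermSpace3 L ι₁} {K : CMField}
    {Ψ : Fin 4 → CMType K} {σ : K →+* ℂ} (h : U.TypeSupply01At V K Ψ σ) : U.TypeSupplyEach01 V K Ψ σ := by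
  obtain ⟨Γ, h₀, h₁⟩ := h
  exact ⟨⟨Γ, h₀⟩, ⟨Γ, h₁⟩⟩

/-- (V₂) ⇒ (V) (take `Γ₀ = Γ₁`). -/
theorem virtualCup11_of_virtualCup11₂ {L : CMField} {ι₁ : L →+* ℂ} {V : HermSpace3 L ι₁} (h : U.VirtualCup11₂ V) :
    U.VirtualCup11 V :=
  fun Γ ω η hω hη => h Γ Γ ω η hω hη

/-- (P♯₂) ⇒ (P♯) (take `Γ₀ = Γ₁`). -/
theorem freePairingAt_of_freePairing2At {L : CMField} {ι₁ : L →+* ℂ} {V : HermSpace3 L ι₁} {K : CMField}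
    {Ψ : Fin 4 → CMType K} {σ : K →+* ℂ} (h : U.FreePairing2At V K Ψ σ) : U.FreePairingAt V K Ψ σ :=
  fun Γ ω₀ ω₁ h₀ h₁ hne₀ hne₁ => h Γ Γ ω₀ ω₁ h₀ h₁ hne₀ hne₁

/-! ### The assembly consumes supply of the (12)-pair only -/

/-- **`PeriodNV` from (S₀₁) and (P♯)** — PROVED, verbatim the gen-1 proof of `periodNV_of_supply_freePairing` (which never used
`i = 2, 3` of (S)). -/
theorem periodNV_of_supply01_freePairing (hc : U.Fact_pull_comp) {L : CMField} {ι₁ : L →+* ℂ} {V : HermSpace3 L ι₁}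
    {K : CMField} {Ψ : Fin 4 → CMType K} {σ : K →+* ℂ}
    (hS : U.TypeSupply01At V K Ψ σ) (hP : U.FreePairingAt V K Ψ σ) : U.PeriodNV ι₁ V K Ψ σ := by
  obtain ⟨Γ, hΓ₀, hΓ₁⟩ := hS
  obtain ⟨ω₀, h₀, hne₀⟩ := (Submodule.ne_bot_iff _).mp hΓ₀
  obtain ⟨ω₁, h₁, hne₁⟩ := (Submodule.ne_bot_iff _).mp hΓ₁
  obtain ⟨Γ', f₀, f₁, ω, e₀, e₁, h₂, h₃, hper⟩ := hP Γ ω₀ ω₁ h₀ h₁ hne₀ hne₁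
  refine periodNV_of_period_ne_zero Γ' ω ?_ hper
  intro i
  match i with
  | 0 => rw [e₀]; exact pullC_mem_Uiso hc f₀ K (Ψ 0) σ h₀
  | 1 => rw [e₁]; exact pullC_mem_Uiso hc f₁ K (Ψ 1) σ h₁
  | 2 => exact h₂
  | 3 => exact h₃

/-- **The (34)-side supply is an OUTPUT**: (S₀₁) ∧ (P♯) ⇒ (S) for all four types (through `PeriodNV` and the honesty lemma
`typeSupplyAt_of_periodNV`).  In PerL v5 this is the remark that `W^L_Alb` for the types `t³, t⁴` follows from Thm 4.4 and is
not used in its proof. -/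
theorem typeSupplyAt_of_supply01_freePairing (hc : U.Fact_pull_comp) {L : CMField} {ι₁ : L →+* ℂ} {V : HermSpace3 L ι₁}
    {K : CMField} {Ψ : Fin 4 → CMType K} {σ : K →+* ℂ}
    (hS : U.TypeSupply01At V K Ψ σ) (hP : U.FreePairingAt V K Ψ σ) : U.TypeSupplyAt V K Ψ σ :=
  typeSupplyAt_of_periodNV (periodNV_of_supply01_freePairing hc hS hP)

/-! ### Two source levels: (S₀₁ᵉ), (V₂), (P) -/

/-- **(V₂) ∧ (P) ⇒ (P♯₂)** — PROVED: translate the two forms (from their two levels) until their cup product is nonzero at a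
common level (V₂), pair (P), compose the morphisms (`Fact_pull_comp`). -/
theorem freePairing2At_of_virtualCup2_pairing (hc : U.Fact_pull_comp) {L : CMField} {ι₁ : L →+* ℂ} {V : HermSpace3 L ι₁}
    {K : CMField} {Ψ : Fin 4 → CMType K} {σ : K →+* ℂ}
    (hV : U.VirtualCup11₂ V) (hP : U.PairingAt V K Ψ σ) : U.FreePairing2At V K Ψ σ := by
  intro Γ₀ Γ₁ ω₀ ω₁ h₀ h₁ hne₀ hne₁
  obtain ⟨Γ₂, f, g, hcup⟩ := hV Γ₀ Γ₁ ω₀ ω₁ hne₀ hne₁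
  have h₀' : U.pullC f 1 ω₀ ∈ U.Uiso Γ₂ K (Ψ 0) σ := pullC_mem_Uiso hc f K (Ψ 0) σ h₀
  have h₁' : U.pullC g 1 ω₁ ∈ U.Uiso Γ₂ K (Ψ 1) σ := pullC_mem_Uiso hc g K (Ψ 1) σ h₁
  obtain ⟨Γ₃, h, ω, e₀, e₁, h₂, h₃, hper⟩ := hP Γ₂ _ _ h₀' h₁' hcup
  refine ⟨Γ₃, U.comp h f, U.comp h g, ω, ?_, ?_, h₂, h₃, hper⟩
  · rw [e₀, pullC_comp_apply hc]
  · rw [e₁, pullC_comp_apply hc]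

/-- **`PeriodNV` from (S₀₁ᵉ) and (P♯₂)** — PROVED. -/
theorem periodNV_of_supplyEach01_freePairing2 (hc : U.Fact_pull_comp) {L : CMField} {ι₁ : L →+* ℂ} {V : HermSpace3 L ι₁}
    {K : CMField} {Ψ : Fin 4 → CMType K} {σ : K →+* ℂ}
    (hS : U.TypeSupplyEach01 V K Ψ σ) (hP : U.FreePairing2At V K Ψ σ) : U.PeriodNV ι₁ V K Ψ σ := by
  obtain ⟨⟨Γ₀, hΓ₀⟩, ⟨Γ₁, hΓ₁⟩⟩ := hS
  obtain ⟨ω₀, h₀, hne₀⟩ := (Submodule.ne_bot_iff _).mp hΓ₀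
  obtain ⟨ω₁, h₁, hne₁⟩ := (Submodule.ne_bot_iff _).mp hΓ₁
  obtain ⟨Γ', f₀, f₁, ω, e₀, e₁, h₂, h₃, hper⟩ := hP Γ₀ Γ₁ ω₀ ω₁ h₀ h₁ hne₀ hne₁
  refine periodNV_of_period_ne_zero Γ' ω ?_ hper
  intro i
  match i with
  | 0 => rw [e₀]; exact pullC_mem_Uiso hc f₀ K (Ψ 0) σ h₀
  | 1 => rw [e₁]; exact pullC_mem_Uiso hc f₁ K (Ψ 1) σ h₁
  | 2 => exact h₂
  | 3 => exact h₃

/-- **`PeriodNV` from (S₀₁ᵉ), (V₂), (P)** — PROVED: the minimal-supply form of the three-piece split (each of the two types of the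
(12)-pair supplied at its own level; nothing assumed about the (34)-pair). -/
theorem periodNV_of_pieces₂ (hc : U.Fact_pull_comp) {L : CMField} {ι₁ : L →+* ℂ} {V : HermSpace3 L ι₁}
    {K : CMField} {Ψ : Fin 4 → CMType K} {σ : K →+* ℂ}
    (hS : U.TypeSupplyEach01 V K Ψ σ) (hV : U.VirtualCup11₂ V) (hP : U.PairingAt V K Ψ σ) :
    U.PeriodNV ι₁ V K Ψ σ :=
  periodNV_of_supplyEach01_freePairing2 hc hS (freePairing2At_of_virtualCup2_pairing hc hV hP)

/-- And then all four types are supplied at one level (output, not input). -/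
theorem typeSupplyAt_of_pieces₂ (hc : U.Fact_pull_comp) {L : CMField} {ι₁ : L →+* ℂ} {V : HermSpace3 L ι₁}
    {K : CMField} {Ψ : Fin 4 → CMType K} {σ : K →+* ℂ}
    (hS : U.TypeSupplyEach01 V K Ψ σ) (hV : U.VirtualCup11₂ V) (hP : U.PairingAt V K Ψ σ) :
    U.TypeSupplyAt V K Ψ σ :=
  typeSupplyAt_of_periodNV (periodNV_of_pieces₂ hc hS hV hP)

variable (U)

/-! ### Under the PerL and the face binders -/

/-- (S₀₁ᵉ) for the PerL data (PerL v5 Thm 4.4's binders): the types `t¹, t²` of the (12)-pair, each at some level. -/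
def TypeSupplyEach01PerL : Prop :=
  ∀ (K L : CMField) (j : K →+* L), IsNormalClosure ℚ K L →
    Module.finrank ℚ K = 6 → (Module.finrank ℚ L = 24 ∨ Module.finrank ℚ L = 48) →
    ∀ (φ : Fin 3 → (K →+* ℂ)), IsFrame φ →
    ∀ (ι₁ : L →+* ℂ), ι₁.comp j = φ 0 →
    ∀ (t : Fin 4 → CMType K), IsPerLTypes φ t →
    ∀ V : HermSpace3 L ι₁, U.TypeSupplyEach01 V K t (φ 0)

/-- (S₀₁ᵉ) for the face data (rfwf v3 Thm 4.1's binders). -/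
def TypeSupplyEach01Face : Prop :=
  ∀ (F : CMField), IsGalois ℚ F → 6 ≤ Module.finrank ℚ F →
    ∀ (f : Face F) (ι₁ : F →+* ℂ), f.Admissible ι₁ →
    ∀ V : HermSpace3 F ι₁, U.TypeSupplyEach01 V F f.psi ι₁

variable {U}

/-- (Ported verbatim from the HodgeCMPerL package; no docstring in the source.) -/
theorem typeSupplyEach01PerL_of_typeSupplyPerL (h : U.TypeSupplyPerL) : U.TypeSupplyEach01PerL :=
  fun K L j hN hK hL φ hφ ι₁ hι t ht V =>
    typeSupplyEach01_of_typeSupply01At (typeSupply01At_of_typeSupplyAt (h K L j hN hK hL φ hφ ι₁ hι t ht V))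

/-- (Ported verbatim from the HodgeCMPerL package; no docstring in the source.) -/
theorem typeSupplyEach01Face_of_typeSupplyFace (h : U.TypeSupplyFace) : U.TypeSupplyEach01Face :=
  fun F hG h6 f ι₁ hadm V =>
    typeSupplyEach01_of_typeSupply01At (typeSupply01At_of_typeSupplyAt (h F hG h6 f ι₁ hadm V))

variable (U)

/-- **PerL Thm 4.4** from the model facts, Venkataramana's theorem (two-level reading) and the minimal pieces (S₀₁ᵉ), (P). -/
theorem perL44_of_pieces₂ (M : U.ModelAxioms) (hV : U.Fact_virtualCup11₂) (hS : U.TypeSupplyEach01PerL)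
    (hP : U.PairingPerL) : U.PerL44 := by
  intro K L j hN hK hL φ hφ ι₁ hι t ht V
  have h4 : 4 ≤ Module.finrank ℚ L := by rcases hL with h | h <;> omega
  exact periodNV_of_pieces₂ M.pull_comp (hS K L j hN hK hL φ hφ ι₁ hι t ht V) (hV L ι₁ h4 V)
    (hP K L j hN hK hL φ hφ ι₁ hι t ht V)

/-- **rfwf Thm 4.1** from the model facts, Venkataramana's theorem (two-level reading) and the minimal face pieces. -/
theorem periodThmF_of_pieces₂ (M : U.ModelAxioms) (hV : U.Fact_virtualCup11₂) (hS : U.TypeSupplyEach01Face)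
    (hP : U.PairingFace) : U.PeriodThmF := by
  intro F hG h6 f ι₁ hι V
  have h4 : 4 ≤ Module.finrank ℚ F := by omega
  exact periodNV_of_pieces₂ M.pull_comp (hS F hG h6 f ι₁ hι V) (hV F ι₁ h4 V) (hP F hG h6 f ι₁ hι V)

/-- **PerL** (`W_per^L`) from the minimal pieces. -/
theorem perL_of_pieces₂ (M : U.ModelAxioms) (hV : U.Fact_virtualCup11₂) (hS : U.TypeSupplyEach01PerL)
    (hP : U.PairingPerL) : U.PerL :=
  Assembly.perL_of_perL44 U StubTree.landherr_exists (perL44_of_pieces₂ U M hV hS hP)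

/-- **`W^{RK4}`** from the minimal face pieces. -/
theorem w_rk4_of_pieces₂ (M : U.ModelAxioms) (hV : U.Fact_virtualCup11₂) (hS : U.TypeSupplyEach01Face)
    (hP : U.PairingFace) : U.W_RK4 :=
  Assembly.w_rk4_of U (periodThmF_of_pieces₂ U M hV hS hP) (StubTree.prop22_surfaceCriterion U M)
    StubTree.landherr_exists M.pms_dim StubTree.admissible_exists

/-- **COR-CM** from the 28 model facts, Venkataramana's Theorem 8 (two-level reading), the minimal face pieces (S₀₁ᵉ), (P)
and the two face-reduction inputs (Pohlmann; [QW8]+Milne). -/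
theorem COR_CM_of_pieces₂ (M : U.ModelAxioms) (hV : U.Fact_virtualCup11₂) (hS : U.TypeSupplyEach01Face)
    (hP : U.PairingFace) (hPo : U.PohlmannSpan) (hQ : U.Qw8Sufficiency) : U.HC_CM :=
  Assembly.hc_cm_of U (w_rk4_of_pieces₂ U M hV hS hP) (StubTree.faceReduction_holds U hPo hQ)
    (StubTree.lemma81_holds U M)

end Universe

end HodgeCM

end
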